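import Mathlib
import Literature.Barriers.PneNP.TSPExtensionComplexity
import Literature.Barriers.PneNP.TSPExtensionComplexityProofs
import Literature.Combinatorics.Optimization.BlockPsdLiftFactorization
import HarnessLib

/-!
# The extension complexity of the correlation polytope: `xc(COR(n)) ≥ 1.5ⁿ`

Fiorini–Massar–Pokutta–Tiwary–de Wolf, Theorem 7 ("There exists some constant `C > 0` such that,
for all `n`, `xc(CUT(n+1)) = xc(COR(n)) ≥ 2^{Cn}`"), in the sharp form of Kaibel–Weltge ("the
extension complexity of the correlation polytope is at least `1.5ⁿ`"), PROVED in the tree's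
slack-form currency `HasEFOfSize` for the tree's correlation polytope
`Literature.Combinatorics.Optimization.FixedSizePsdRank.corPolytope n = conv{bbᵀ : b ∈ {0,1}ⁿ} ⊆ ℝ^{n·n}`
(`BlockPsdLiftFactorization.lean`):

* `corPolytope_three_pow_le : HasEFOfSize (corPolytope n) r → 3 ^ n ≤ (r + 1) * 2 ^ n`;
* `corPolytope_xc_ge : HasEFOfSize (corPolytope n) r → (3/2 : ℝ) ^ n ≤ r + 1`.

This is the base case on which the minor and face transfer results for correlation, cut and stable
set polytopes rest (FMPTW Thm. 8 and Lemma 9, Avis–Tiwary Cor. 5, Aboulker–Fiorini–Huynh–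
Macchia–Seif "[KW15]: `xc(COR(K_h)) ≥ 1.5^h`"); it does not by itself discharge any named fact.

## Proof (the printed one, assembled from tree components)

FMPTW §4: the `2ⁿ` vertices `bbᵀ` (`b ⊆ [n]`) and the `2ⁿ` inequalities
`⟨2 diag(a) - aaᵀ, x⟩ ≤ 1` (`a ⊆ [n]`), valid on `COR(n)` (Lemma 6: on a `0/1` point `x` the form is
`2k - k²` with `k = |a ∩ supp x|`, and `2k - k² ≤ 1`; validity passes to the hull —
`FixedSizePsdRank.flat_dotProduct_le_of_mem_corPolytope`), have slack matrix
`M_ab = (1 - aᵀb)² = (1 - |a ∩ b|)²` (`slack` in the proof), which is positive on disjoint pairs and vanishes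
exactly when `|a ∩ b| = 1`.  The tree's generic `HasEFOfSize.three_pow_le`
(`TSPExtensionComplexityProofs.lean`; Yannakakis' rectangle cover `HasEFOfSize.exists_cover_option`
+ Kaibel–Weltge's count `three_pow_le_card_mul_two_pow_of_cover_univ`) turns exactly this pattern
into `3ⁿ ≤ (r + 1)·2ⁿ`.

No new definition, no named fact.

## References

* S. Fiorini, S. Massar, S. Pokutta, H. R. Tiwary, R. de Wolf, *Exponential lower bounds for
  polytopes in combinatorial optimization*, J. ACM 62 (2015), art. 17 = arXiv:1111.0837; §4.1
  eq. (4) (`M_ab = 1 - ⟨2 diag(a) - aaᵀ, bbᵀ⟩`, p. 7), Lemma 6 and eq. (5) (p. 9), Theorem 7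
  (p. 9).  Bib key `FioriniEtAl2015`.
* V. Kaibel, S. Weltge, *A short proof that the extension complexity of the correlation polytope
  grows exponentially*, Discrete Comput. Geom. 53 (2015) 397–401 = arXiv:1307.3543, Thm. 1
  (`ϱ(n) ≤ 2ⁿ`, hence `xc(COR(n)) ≥ 1.5ⁿ`) and §3.  Bib key `KaibelWeltge2014`.
-/

noncomputable section

namespace Literature.Barriers.PneNP

open Matrix Finset
open Literature.Combinatorics.Optimization.FixedSizePsdRank

/-- `⟨2 diag(u) - uuᵀ, x xᵀ⟩ = 2 Σ_i u_i x_i² - (Σ_i u_i x_i)²` for any weight vector `u` (FMPTW's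
verification of eq. (4) with `u = a`). [cite: FioriniEtAl2015, §4.1, eq. (4) (arXiv:1111.0837 p. 7)] -/
private theorem quad_two_diag_sub_outer {n : ℕ} (u x : Fin n → ℝ) :
    ∑ i, ∑ j, (2 * (if i = j then 1 else 0) * u i - u i * u j) * (x i * x j) =
      2 * (∑ i, u i * (x i * x i)) - (∑ i, u i * x i) ^ 2 := by
  simp only [sub_mul, Finset.sum_sub_distrib]
  congr 1
  · rw [Finset.mul_sum]
    refine Finset.sum_congr rfl fun i _ => ?_
    rw [Finset.sum_eq_single i]
    · simp; ring
    · intro j _ hji; simp [Ne.symm hji]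
    · intro h; exact absurd (Finset.mem_univ i) h
  · rw [sq, Finset.sum_mul_sum]
    refine Finset.sum_congr rfl fun i _ => Finset.sum_congr rfl fun j _ => ?_
    ring

/-- The indicator `𝟙_a` as the tree's `bvec` of the Boolean indicator of `a`. [folklore] -/
private theorem bvec_decide_apply {n : ℕ} (a : Finset (Fin n)) (i : Fin n) :
    bvec (fun i => decide (i ∈ a)) i = if i ∈ a then 1 else 0 := by
  by_cases h : i ∈ a <;> simp [bvec, h]

/-- **`xc(COR(n)) ≥ 1.5ⁿ` (FMPTW 2015 Thm. 7 in Kaibel–Weltge's sharp form), slack-form currency**: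
if the correlation polytope `COR(n) = conv{bbᵀ : b ∈ {0,1}ⁿ}` (`FixedSizePsdRank.corPolytope n`,
flattened to `ℝ^{n·n}`) has an extended formulation with `r` inequalities then `3ⁿ ≤ (r + 1)·2ⁿ`.
Proof as printed: the `2ⁿ` vertices `bbᵀ` and the `2ⁿ` valid inequalities `⟨2 diag(a) - aaᵀ, x⟩ ≤ 1`
(Lemma 6: on a `0/1` point the form is `2k - k² ≤ 1`, `k = |a ∩ supp x|`; validity passes to the
hull by `flat_dotProduct_le_of_mem_corPolytope`) have slack matrix `(1 - |a ∩ b|)²` — positive on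
disjoint pairs, zero when `|a ∩ b| = 1` — so the tree's generic `HasEFOfSize.three_pow_le`
(Yannakakis cover + Kaibel–Weltge count `ϱ(n) ≤ 2ⁿ`, `TSPExtensionComplexityProofs.lean`) applies.
(The `+1` is the tree's factorisation-through-`Option (Fin r)` convention; immaterial for lower
bounds.) [cite: FioriniEtAl2015, Thm. 7 with Lemma 6 (arXiv:1111.0837 p. 9)]
[cite: KaibelWeltge2014, Thm. 1 and §3 (xc(COR(n)) ≥ 1.5ⁿ; PDF pp. 4, 6)] -/
theorem corPolytope_three_pow_le {n r : ℕ}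
    (h : HasEFOfSize (Literature.Combinatorics.Optimization.FixedSizePsdRank.corPolytope n) r) :
    3 ^ n ≤ (r + 1) * 2 ^ n := by
  classical
  -- `𝟙_a`, the vertices `𝟙_b 𝟙_bᵀ` and the matrices `2 diag(𝟙_a) - 𝟙_a 𝟙_aᵀ`
  let ind : Finset (Fin n) → Fin n → ℝ := fun a => bvec fun i => decide (i ∈ a)
  have ind_apply : ∀ a i, ind a i = if i ∈ a then 1 else 0 := fun a i => bvec_decide_apply a i
  have ind_sq : ∀ a i, ind a i * ind a i = ind a i := fun a i => by
    rw [ind_apply]; by_cases hi : i ∈ a <;> simp [hi]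
  have ind_inter : ∀ a b, ∑ i, ind a i * ind b i = ((a ∩ b).card : ℝ) := by
    intro a b
    have : ∀ i, ind a i * ind b i = if i ∈ a ∩ b then 1 else 0 := fun i => by
      rw [ind_apply, ind_apply]
      by_cases ha : i ∈ a <;> by_cases hb : i ∈ b <;> simp [ha, hb]
    simp only [this]
    rw [Finset.sum_boole, Finset.filter_mem_eq_inter, Finset.univ_inter]
  let pt : Finset (Fin n) → Fin (n * n) → ℝ := fun b => vecOuter n (ind b)
  have pt_mem : ∀ b, pt b ∈ corPolytope n := fun b =>
    subset_convexHull ℝ _ ⟨fun i => decide (i ∈ b), rfl⟩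
  let M : Finset (Fin n) → Matrix (Fin n) (Fin n) ℝ := fun a i j =>
    2 * (if i = j then 1 else 0) * ind a i - ind a i * ind a j
  -- Lemma 6: validity on `0/1` points, slack `(1 - |a ∩ b|)²` at the vertices
  have valid01 : ∀ a (x : Fin n → ℝ), (∀ i, x i = 0 ∨ x i = 1) →
      ∑ i, ∑ j, M a i j * (x i * x j) ≤ 1 := by
    intro a x hx
    show ∑ i, ∑ j, (2 * (if i = j then 1 else 0) * ind a i - ind a i * ind a j) * (x i * x j) ≤ 1
    rw [quad_two_diag_sub_outer]
    have hsq : ∀ i, x i * x i = x i := fun i => by rcases hx i with h | h <;> simp [h]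
    simp only [hsq]
    nlinarith [sq_nonneg (∑ i, ind a i * x i - 1)]
  have slack : ∀ a b, 1 - flat (M a) ⬝ᵥ pt b = (1 - ((a ∩ b).card : ℝ)) ^ 2 := by
    intro a b
    show 1 - flat (M a) ⬝ᵥ vecOuter n (ind b) = _
    rw [flat_dotProduct_vecOuter]
    show 1 - ∑ i, ∑ j, (2 * (if i = j then 1 else 0) * ind a i - ind a i * ind a j) *
      (ind b i * ind b j) = _
    rw [quad_two_diag_sub_outer]
    simp only [ind_sq, ind_inter]
    ring
  refine h.three_pow_le pt pt_mem (fun a => flat (M a)) (fun _ => 1) ?_ ?_ ?_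
  · intro a y hy
    exact flat_dotProduct_le_of_mem_corPolytope hy ⟨(M a, 1), fun x hx => valid01 a x hx⟩
  · intro a b hlt hone
    have := slack a b
    rw [hone] at this
    norm_num at this
    linarith
  · intro a b hab
    have := slack a b
    rw [Finset.disjoint_iff_inter_eq_empty.1 hab, Finset.card_empty] at this
    norm_num at this
    linarith

/-- The same bound as a real exponential: `(3/2)ⁿ ≤ r + 1` for every size `r` of an extended
formulation of `COR(n)`. [cite: KaibelWeltge2014, Thm. 1 and §3 (PDF pp. 4, 6)]
[cite: FioriniEtAl2015, Thm. 7 (arXiv:1111.0837 p. 9)] -/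
theorem corPolytope_xc_ge {n r : ℕ}
    (h : HasEFOfSize (Literature.Combinatorics.Optimization.FixedSizePsdRank.corPolytope n) r) :
    (3 / 2 : ℝ) ^ n ≤ r + 1 := by
  have h3 := corPolytope_three_pow_le h
  have h2 : (0 : ℝ) < 2 ^ n := by positivity
  rw [div_pow, div_le_iff₀ h2]
  exact_mod_cast h3

end Literature.Barriers.PneNP

end
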